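import Mathlib
import Literature.NumberTheory.LFunctions.Zhang2022.Section15BEq1517OfRanged
import Literature.NumberTheory.LFunctions.Zhang2022.Section15BEq1515Ranged
import HarnessLib

/-!
# Zhang (2022) §15 (15.17) at the χ-twisted coefficients — the leaf `Eq15_17 c′ bChi` CLOSED BY NAME
# (theorems only)

Topic `Literature/NumberTheory/LFunctions/Zhang2022` (Landau–Siegel audit tree; verdict-neutral).
Y. Zhang, *Discrete mean estimates and the Landau–Siegel zero*, arXiv:2211.02515v1 (2022)
[Zhang2022LandauSiegel] — **an unrefereed manuscript under adjudication; nothing here asserts or denies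
its Theorems 1–2.** Display (15.17), §15 p. 85 (tex L4226): "Inserting this into (15.11) and substituting
`n = dl` we obtain `Φ₁(p) = ℛ₁*Dpφ(D)⁻¹Σ_{j≤3}ℛ_{1j}𝒮_{1j} + o(p)`", in the reading of record `b := χ·b`
(`Typed.Section15A.bChi`, cell row G-L4t1-1). Lane ZHANG-L, WP15: this file closes the skeleton leaf
`h15_17 : ∀ c′ ≥ c₁, Typed.Section15B.Eq15_17 c′ Typed.Section15A.bChi` (v19 binder, rank 11) for EVERY
`c′`, by composing zl-w09-p1's assembly edge `Typed.Section15B.eq15_17_chi_of_eq15_15_ranged` (p484249: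
(15.11)@bChi from `step15_u021_holds` + the ranged/weighted (15.15) + the divisor-weight bookkeeping,
any error exponent `A ≥ 61`) with the ranged (15.15) of record `Eq1515.eq15_15_ranged` (p486572, exponent
`A = 1994`; contour core zl-w15-p1, analytic package zl-w09-p1, residue side zl-w10-p6, assembly
zl-w15-typer). Theorems only; no definitions; standard axioms. WHAT THIS IS NOT: a claim about
Theorems 1–2 of the manuscript or about Landau–Siegel zeros; nor a proof of (15.15)/(15.17) at the
PRINTED coefficients `bLit` (off by `χ(m)` at §15.u014, row G-L4t1-1).

## References
* Y. Zhang, arXiv:2211.02515v1 (2022), §15 (15.11)–(15.17) pp. 82–85. [cite: Zhang2022LandauSiegel, §15 (15.17) p. 85]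
-/

noncomputable section

namespace Literature.NumberTheory.LFunctions.Zhang2022.Typed.Section15B

open Literature.NumberTheory.LFunctions.Zhang2022.Typed.Section15A

/-- **(15.17) at `b := χ·b`, for every `c′`** — the skeleton leaf `h15_17` BY NAME:
`Eq15_17 c′ bChi`, from `eq15_17_chi_of_eq15_15_ranged` (A := 1994) and `Eq1515.eq15_15_ranged`.
Skeleton plug: `fun c' _ => Typed.Section15B.eq15_17_chi_holds c'`.
[cite: Zhang2022LandauSiegel, §15 (15.17) p. 85] -/
theorem eq15_17_chi_holds (c' : ℝ) : Eq15_17 c' bChi :=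
  eq15_17_chi_of_eq15_15_ranged c' (A := 1994) (by norm_num) (Eq1515.eq15_15_ranged c')

/-- The same in the eventual shape `∃ c₀, ∀ c′ ≥ c₀, Eq15_17 c′ bChi` (any `c₀`, e.g. `0`).
[cite: Zhang2022LandauSiegel, §15 (15.17) p. 85] -/
theorem eq15_17_chi_eventually : ∃ c₀ : ℝ, ∀ c' : ℝ, c₀ ≤ c' → Eq15_17 c' bChi :=
  ⟨0, fun c' _ => eq15_17_chi_holds c'⟩

end Literature.NumberTheory.LFunctions.Zhang2022.Typed.Section15B

end
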